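import Summits.CriticalPhenomena.Ising3DConformalLimit.Theorems.ReflectionTwinExistsContinuousLimitWeightedIffExponent
import HarnessLib

/-!
# K1′ ⟸ item 4657 by name: the open stub of line `Sketch` is an alias of `ClusterRigidity.ClusterPointsMoebius`
# (crux `ExistsContinuousLimit`, stmt-CriticalPhenomena-4582; registered sub-goal
# `stub_clusterPointInversionCovariant_of_clusterPointsMoebius`)

The open stub K1′ `stub_clusterPointInversionCovariant` of line `Sketch` (every normalised cluster point of the pinned
`ℤ³` zoom is covariant under the unit inversion with SOME continuous positive weight) follows from item 4657
`ClusterRigidity.ClusterPointsMoebius` BY NAME: a cluster point in the sense of `IsClusterPoint` (mesh sequence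
`u k → 0⁺`, finitely many meshes may exceed `1`) becomes a member of the cluster set of items 4657/4659 (meshes in
`(0,1]`, renormalisation written inline) after dropping an initial segment of the sequence
(`mem_clusterSet_of_isClusterPoint`), item 4657 then gives Möbius covariance with some `Δ`, whose inversion clause is
K1′ with the weight `‖·‖^{2Δ}` (`clusterPointInversionCovariant_iff_exists_exponent`, p156705). Together with the landed
converse direction `clusterPointsMoebius_of_doubling_of_inversionCovariant` (item 6150 ∧ K1′ ⟹ item 4657 up to its
sign clause `0 < Δ`, p156070/p156418) this places K1′ exactly: 4657 ⟹ K1′ ⟹ (4657 minus sign, given 6150). Nothing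
here is progress on the open problem; it pins the stub to an existing item for the ledger. [folklore]
-/

noncomputable section

namespace Summit.CriticalPhenomena.Ising3DConformalLimit.ReflectionTwinExistsContinuousLimit

open Literature.Probability.LatticeModels Filter Set
open scoped Topology
open Summit.CriticalPhenomena.Ising3DConformalLimit.MoebiusLimitExistsOnlyInteraction (rhoPin IsClusterPoint)
open Summit.CriticalPhenomena.Ising3DConformalLimit.Cruxes.ExistsScaleCovariantLimit.TwoHierarchies
  (rhoStar_eq_rhoPin)

/-- Re-indexing a locally uniform limit along a map of index filters (here: dropping an initial segment of a
sequence). [folklore] -/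
theorem tendstoLocallyUniformlyOn_comp_index {α β ι ι' : Type*} [TopologicalSpace α] [UniformSpace β]
    {F : ι → α → β} {f : α → β} {p : Filter ι} {p' : Filter ι'} {s : Set α} {φ : ι' → ι}
    (h : TendstoLocallyUniformlyOn F f p s) (hφ : Tendsto φ p' p) :
    TendstoLocallyUniformlyOn (fun m => F (φ m)) f p' s := by
  intro u hu x hx
  obtain ⟨t, ht, hev⟩ := h u hu x hx
  exact ⟨t, ht, hφ.eventually hev⟩

/-- **A cluster point of the pinned zoom is a member of the cluster set of items 4657/4659**: its mesh sequence
`u k → 0⁺` is eventually in `(0,1]`; shifting past that index gives a mesh sequence in `(0,1]` tending to `0`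
along which the same locally uniform convergence holds, with `ρ_pin` written inline (`rhoStar_eq_rhoPin`).
[folklore] -/
theorem mem_clusterSet_of_isClusterPoint {S : CorrFamily 3} (hS : IsClusterPoint S) :
    ∃ u : ℕ → ℝ, (∀ k, u k ∈ Set.Ioc (0:ℝ) 1) ∧ Tendsto u atTop (𝓝 0) ∧
      ∀ n, TendstoLocallyUniformlyOn
        (fun k => rescaledCorrelator (criticalCorr 3)
          (fun δ : ℝ => (criticalTwoPoint 3 (Pi.single 0 ⌊δ⁻¹⌋)) ^ (-(1/2:ℝ))) n (u k))
        (S n) atTop (NonCoincident 3 n) := by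
  obtain ⟨u, hu, hconv⟩ := hS
  have hu' := tendsto_nhdsWithin_iff.1 hu
  have hev : ∀ᶠ k in atTop, u k ∈ Set.Ioc (0:ℝ) 1 := by
    have h1 : ∀ᶠ k in atTop, u k < 1 := (tendsto_order.1 hu'.1).2 1 one_pos
    filter_upwards [h1, hu'.2] with k hk1 hk0
    exact ⟨hk0, hk1.le⟩
  obtain ⟨N, hN⟩ := eventually_atTop.1 hev
  refine ⟨fun k => u (k + N), fun k => hN _ (Nat.le_add_left N k), hu'.1.comp (tendsto_add_atTop_nat N),
    fun n => ?_⟩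
  rw [rhoStar_eq_rhoPin]
  exact tendstoLocallyUniformlyOn_comp_index (F := fun k => rescaledCorrelator (criticalCorr 3) rhoPin n (u k))
    (φ := fun k => k + N) (hconv n) (tendsto_add_atTop_nat N)

/-- **Registered sub-goal `stub_clusterPointInversionCovariant_of_clusterPointsMoebius`: item 4657
`ClusterRigidity.ClusterPointsMoebius` ⟹ K1′** (the open stub `stub_clusterPointInversionCovariant` of line `Sketch`,
verbatim), with the weight `‖·‖^{2Δ}` of the item's Möbius exponent. [folklore] -/
theorem stub_clusterPointInversionCovariant_of_clusterPointsMoebius :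
    Summit.CriticalPhenomena.Ising3DConformalLimit.Theses.ClusterRigidity.ClusterPointsMoebius →
    ∀ S : Literature.Probability.LatticeModels.CorrFamily 3,
      (∀ n z, z ∉ Literature.Probability.LatticeModels.NonCoincident 3 n → S n z = 0) →
      Summit.CriticalPhenomena.Ising3DConformalLimit.MoebiusLimitExistsOnlyInteraction.IsClusterPoint S →
      ∃ w : EuclideanSpace ℝ (Fin 3) → ℝ, (∀ v, v ≠ 0 → 0 < w v) ∧ ContinuousOn w {0}ᶜ ∧
        ∀ (n : ℕ) (x : Fin n → EuclideanSpace ℝ (Fin 3)), (∀ i, x i ≠ 0) →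
          S n (fun i => EuclideanGeometry.inversion (0 : EuclideanSpace ℝ (Fin 3)) 1 (x i)) =
            (∏ i, w (x i)) * S n x := by
  intro h4657 S hN hS
  obtain ⟨u, hu1, hu0, hconv⟩ := mem_clusterSet_of_isClusterPoint hS
  obtain ⟨Δ, -, hM⟩ := h4657 S ⟨hN, u, hu1, hu0, hconv⟩
  exact (clusterPointInversionCovariant_iff_exists_exponent S hN hS).2 ⟨Δ, hM.isInversionCovariant⟩

end Summit.CriticalPhenomena.Ising3DConformalLimit.ReflectionTwinExistsContinuousLimit

end
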